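import Mathlib
import Summits.Ventures.PercRepro.TriangleCapRowA1CapMain
import Summits.Ventures.PercRepro.TriangleCapRowA1Last

/-!
# PercRepro — THE ROW `r = a + 1` OF THE STABILITY TABLE FOR EVERY `8 ≤ a ≤ 18`: on the cell `(k, a, a + 1)`,
`k ≥ 3a + 1`, every `K₄⁻`-free graph that is not `a`-bipartite is at least `2k − 10` below the closed form, and the
double broom of the other bipartition attains it (p3, gen 47; part 200v)

Beyond `r = a` the other bipartition `K_{a+1,k−a−1}` misses `k − a` pairs — one more than a star at a non-isolated
vertex holds — and its best non-`a`-bipartite graphs are the double brooms (a `(k − a − 2)`-star and two pairs at a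
second vertex sharing leaves), `2k − 10` below; the one-triangle family is `2k + 2a − 20` below. NO INDUCTION: the
cap is part 200s, the window `rowA1_window`, a vertex `z` of degree `d ≤ a − 1` is deleted onto `(k − 1, a, d + 1)`
— a `B2` cell (`d ≤ a − 4`), the `T` cell (`d = a − 3`), the `B2` cell `r = a − 1` (`d = a − 2`), the cell `r = a`
(`d = a − 1`, part 200p) — through `sides_A1_gen`, `rowA1_mixed`, and at `d = a − 1` the last mixed case
(`rowA1_last_mixed`, part 200v′). Axioms: standard.
-/

namespace PercRepro

namespace TriangleCap

namespace C047

open Finset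

variable {V : Type*} [Fintype V] [DecidableEq V]

/-- **THE ROW `r = a + 1`, `8 ≤ a ≤ 18`, `3a + 1 ≤ k`:** `K₄⁻`-free, `m + (a + 1) = a (k − a)` ⇒ `a`-bipartite or
`Σ_v d(v)² + (a + 1)(k − 1 − (a + 1)) + (2k − 10) ≤ m k`. -/
theorem rowA1_second_order_gen (D : SimpleGraph V) [DecidableRel D.Adj] (hK : K4mFree D) (a : ℕ)
    (ha8 : 8 ≤ a) (ha18 : a ≤ 18) (hk : 3 * a + 1 ≤ Fintype.card V)
    (hm : D.edgeFinset.card + (a + 1) = a * (Fintype.card V - a)) :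
    (∃ A : Finset V, A.card = a ∧ BipSub D A) ∨
      ∑ v, deg D v * deg D v + (a + 1) * (Fintype.card V - 1 - (a + 1)) + (2 * Fintype.card V - 10) ≤
        D.edgeFinset.card * Fintype.card V := by
  have hk2 : 2 * a + 2 ≤ Fintype.card V := by omega
  -- (A) a vertex at the cap
  by_cases hx : ∃ x, deg D x + a = Fintype.card V
  · obtain ⟨x, hx⟩ := hx
    exact cap_A1_gen D hK a ha8 hk hm x hx
  push Not at hx
  have hcap : ∀ v, deg D v + a ≤ Fintype.card V := fun v =>
    deg_add_le_card_of_dense D hK a (by omega) (by omega)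
      (cap_arith a (Fintype.card V) D.edgeFinset.card (a + 1) (by omega) (by omega)
        (below_cap_arith a (Fintype.card V) D.edgeFinset.card (a + 1) (by omega) hm)) v
  have hcap' : ∀ v, deg D v + a + 1 ≤ Fintype.card V := fun v => by
    have h1 := hcap v
    have h2 := hx v
    omega
  have hcap2 : ∀ v, deg D v ≤ (Fintype.card V - a - 2) + 1 := fun v => by have := hcap' v; omega
  -- (B) every degree `≥ a`: the window
  by_cases hdeg : ∀ v, a ≤ deg D v
  · exact Or.inr (rowA1_window D a (by omega) hk hm hcap' hdeg)
  push Not at hdeg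
  obtain ⟨z, hz⟩ := hdeg
  -- the deletion bookkeeping: `D − z` on `(k − 1, a, d + 1)`
  have hK' := k4mFree_del D hK z
  have hcard' := card_del z
  have hedges' := card_edges_del D z
  have hsq := sum_deg_sq_del D z
  have hT := sum_del_nbhd_le D z (Fintype.card V - a - 2) hcap2
  obtain ⟨T, hTdef⟩ : ∃ T, ∑ w : {v : V // v ≠ z}, (if D.Adj w.1 z then deg (del D z) w else 0) = T := ⟨_, rfl⟩
  obtain ⟨S', hS'def⟩ : ∃ S', ∑ w : {v : V // v ≠ z}, deg (del D z) w * deg (del D z) w = S' := ⟨_, rfl⟩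
  obtain ⟨m', hm'def⟩ : ∃ m', (del D z).edgeFinset.card = m' := ⟨_, rfl⟩
  rw [hTdef, hS'def] at hsq
  rw [hTdef] at hT
  rw [hm'def] at hedges'
  have hcardV' : Fintype.card {v : V // v ≠ z} = Fintype.card V - 1 := by omega
  have hm' : (del D z).edgeFinset.card + (deg D z + 1) = a * (Fintype.card {v : V // v ≠ z} - a) := by
    rw [hm'def, hcardV']
    exact below_cell_edges a (a + 1) (deg D z + 1) (deg D z) (Fintype.card V) D.edgeFinset.card m' hk2 (by omega)
      hedges' hm
  have hmd : m' + deg D z + (a + 1) = a * (Fintype.card V - a) := by omega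
  have hside : ∀ A' : Finset {v : V // v ≠ z}, A'.card = a → BipSub (del D z) A' →
      (∃ A : Finset V, A.card = a ∧ BipSub D A) ∨
        (∑ v, deg D v * deg D v + (a + 1) * (Fintype.card V - 1 - (a + 1)) + (2 * Fintype.card V - 10) ≤
          D.edgeFinset.card * Fintype.card V) ∨
        (2 ≤ deg D z ∧ T + (Fintype.card V - a - 2) ≤ deg D z * (Fintype.card V - a - 2) + a) := by
    intro A' hA'card hB
    have := sides_A1_gen D a (by omega) hk hm z (by omega) A' hA'card hB hm' hcap2
    rw [hTdef] at this
    exact this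
  rcases Nat.lt_or_ge (deg D z + 3) a with hd4 | hd4
  · -- `d ≤ a − 4`: a `B2` cell `(k − 1, a, d + 1)`
    rcases below_second_order_all (del D z) hK' a (deg D z + 1) (by omega) ha18 (by omega) (by omega) hm'
      with ⟨A', hA'card, hB⟩ | hgap
    · rcases hside A' hA'card hB with h | h | ⟨h2, hT'⟩
      · exact Or.inl h
      · exact Or.inr h
      · right
        have hS := sum_deg_sq_le_of_bipSub (del D z) A' hB a (deg D z + 1) hA'card hm' (by omega)
        rw [hS'def, hm'def, hcardV'] at hS
        rw [hsq, ← hedges']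
        exact rowA1_mixed a (deg D z) (Fintype.card V) m' S' T ha8 h2 (by omega) hk hmd hS hT'
    · right
      rw [hS'def, hm'def, hcardV'] at hgap
      rw [hsq, ← hedges']
      exact rowA1_del_B2 a (deg D z) (Fintype.card V) m' S' T ha8 (by omega) hk hmd hgap hT
  · rcases Nat.lt_or_ge (deg D z + 2) a with hd3 | hd3
    · -- `d = a − 3`: the `T` cell
      have hda : deg D z = a - 3 := by omega
      have hr' : deg D z + 1 = a - 2 := by omega
      rw [hr'] at hm'
      rw [hda] at hT hedges' hmd
      rcases rowT_second_order_gen (del D z) hK' a (a - 2) (by omega) ha18 (by omega) (by omega) hm'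
        with ⟨A', hA'card, hB⟩ | hgap
      · rw [← hr'] at hm'
        rcases hside A' hA'card hB with h | h | ⟨h2, hT'⟩
        · exact Or.inl h
        · exact Or.inr h
        · right
          have hS := sum_deg_sq_le_of_bipSub (del D z) A' hB a (deg D z + 1) hA'card hm' (by omega)
          rw [hS'def, hm'def, hcardV'] at hS
          rw [hda] at hT' h2 hS
          rw [hsq, ← hedges', hda]
          exact rowA1_mixed a (a - 3) (Fintype.card V) m' S' T ha8 h2 (by omega) hk hmd hS hT'
      · right
        rw [hS'def, hm'def, hcardV'] at hgap
        rw [hsq, ← hedges', hda]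
        exact rowA1_del_T a (Fintype.card V) m' S' T ha8 hk hmd hgap hT
    · rcases Nat.lt_or_ge (deg D z + 1) a with hd2 | hd2
      · -- `d = a − 2`: the `B2` cell `r′ = a − 1`
        have hda : deg D z = a - 2 := by omega
        have hr' : deg D z + 1 = a - 1 := by omega
        rw [hr'] at hm'
        rw [hda] at hT hedges' hmd
        rcases rowB_second_order_all (del D z) hK' a (a - 1) (by omega) ha18 (by omega) (by omega) hm'
          with ⟨A', hA'card, hB⟩ | hgap
        · rw [← hr'] at hm'
          rcases hside A' hA'card hB with h | h | ⟨h2, hT'⟩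
          · exact Or.inl h
          · exact Or.inr h
          · right
            have hS := sum_deg_sq_le_of_bipSub (del D z) A' hB a (deg D z + 1) hA'card hm' (by omega)
            rw [hS'def, hm'def, hcardV'] at hS
            rw [hda] at hT' h2 hS
            rw [hsq, ← hedges', hda]
            exact rowA1_mixed a (a - 2) (Fintype.card V) m' S' T ha8 h2 (by omega) hk hmd hS hT'
        · right
          rw [hS'def, hm'def, hcardV'] at hgap
          rw [hsq, ← hedges', hda]
          exact rowA1_del_B a (Fintype.card V) m' S' T ha8 hk hmd hgap hT
      · -- `d = a − 1`: the cell `r′ = a` and the last mixed case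
        have hda : deg D z = a - 1 := by omega
        have hr' : deg D z + 1 = a := by omega
        have hm'a : (del D z).edgeFinset.card + a = a * (Fintype.card {v : V // v ≠ z} - a) := by
          have h := hm'
          rw [hr'] at h
          exact h
        rcases rowA_second_order_gen (del D z) hK' a (by omega) ha18 (by omega) hm'a
          with ⟨A', hA'card, hB⟩ | hgap
        · by_cases hall : ∀ w : {v : V // v ≠ z}, D.Adj w.1 z → w ∈ A'
          · obtain ⟨B, hBcard, hBsub⟩ := bipSub_lift D z A' hB hall
            exact Or.inl ⟨B, by rw [hBcard, hA'card], hBsub⟩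
          push Not at hall
          obtain ⟨w₀, hw₀z, hw₀A⟩ := hall
          by_cases hnone : ∀ w : {v : V // v ≠ z}, D.Adj w.1 z → w ∉ A'
          · exact Or.inr (rowA1_alloff D a (by omega) hk hm z (by omega) A' hA'card hB hm' hnone w₀ hw₀z)
          push Not at hnone
          obtain ⟨w₁, hw₁z, hw₁A⟩ := hnone
          exact Or.inr (rowA1_last_mixed D hK a ha8 hk hm z hda A' hA'card hB hm'a hcap2 w₀ hw₀A hw₀z w₁ hw₁A
            hw₁z)
        · right
          rw [hS'def, hm'def, hcardV'] at hgap
          rw [hda] at hT hedges' hmd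
          rw [hsq, ← hedges', hda]
          exact rowA1_del_A a (Fintype.card V) m' S' T ha8 hk hmd hgap hT

/-- **THE DOUBLE BROOM** on `Fin k`: `K_{a+1,k−a−1}` minus a `(k − a − 2)`-star at `0` minus the pairs `{1, a + 1}` and
`{1, a + 2}` (two more pairs at the vertex `1`, sharing leaves with the star). -/
abbrev doubleBroom (k a : ℕ) (h1 : 1 < k) (hak : a + 1 < k) (hak2 : a + 2 < k) : SimpleGraph (Fin k) :=
  delEdge (delEdge (bipMinusStar k (a + 1) (k - a - 2)) ⟨1, h1⟩ ⟨a + 1, hak⟩) ⟨1, h1⟩ ⟨a + 2, hak2⟩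

/-- **THE DOUBLE BROOM ON `(k, a, a + 1)`:** `K₄⁻`-free with `a (k − a) − (a + 1)` edges, `a`-bipartite for no `A`,
and `Σ_v d(v)² + (a + 1)(k − 1 − (a + 1)) + (2k − 10) = m k` (`4 ≤ a`, `3a + 1 ≤ k`). -/
theorem rowA1_witness (k a : ℕ) (ha4 : 4 ≤ a) (hk : 3 * a + 1 ≤ k) (h1 : 1 < k) (hak : a + 1 < k)
    (hak2 : a + 2 < k) :
    K4mFree (doubleBroom k a h1 hak hak2) ∧
      (doubleBroom k a h1 hak hak2).edgeFinset.card + (a + 1) = a * (k - a) ∧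
      (¬ ∃ A : Finset (Fin k), A.card = a ∧ BipSub (doubleBroom k a h1 hak hak2) A) ∧
      ∑ v, deg (doubleBroom k a h1 hak hak2) v * deg (doubleBroom k a h1 hak hak2) v +
          (a + 1) * (k - 1 - (a + 1)) + (2 * k - 10) =
        (doubleBroom k a h1 hak hak2).edgeFinset.card * k := by
  have hk0 : 0 < k := by omega
  unfold doubleBroom
  -- the two deleted pairs are edges of `B`, and `{1, a + 2}` survives the first deletion
  have hadj1 : (bipMinusStar k (a + 1) (k - a - 2)).Adj ⟨1, h1⟩ ⟨a + 1, hak⟩ := by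
    rw [bipMinusStar_adj]
    simp only
    refine ⟨?_, ?_⟩
    · rw [Xor]; omega
    · omega
  have hadj2 : (bipMinusStar k (a + 1) (k - a - 2)).Adj ⟨1, h1⟩ ⟨a + 2, hak2⟩ := by
    rw [bipMinusStar_adj]
    simp only
    refine ⟨?_, ?_⟩
    · rw [Xor]; omega
    · omega
  have hadj2' : (delEdge (bipMinusStar k (a + 1) (k - a - 2)) ⟨1, h1⟩ ⟨a + 1, hak⟩).Adj ⟨1, h1⟩ ⟨a + 2, hak2⟩ := by
    rw [delEdge_adj]
    refine ⟨hadj2, ?_⟩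
    simp only [Fin.ext_iff]
    omega
  have hE := card_edges_bipMinusStar k (a + 1) (k - a - 2) (by omega) (by omega)
  have hS := (sums_bipMinusStar k (a + 1) (k - a - 2) (by omega) (by omega)).2
  have hE1 := card_edges_delEdge (bipMinusStar k (a + 1) (k - a - 2)) hadj1
  have hS1 := sum_deg_sq_delEdge (bipMinusStar k (a + 1) (k - a - 2)) hadj1
  have hE2 := card_edges_delEdge (delEdge (bipMinusStar k (a + 1) (k - a - 2)) ⟨1, h1⟩ ⟨a + 1, hak⟩) hadj2'
  have hS2 := sum_deg_sq_delEdge (delEdge (bipMinusStar k (a + 1) (k - a - 2)) ⟨1, h1⟩ ⟨a + 1, hak⟩) hadj2'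
  have hd1 : deg (bipMinusStar k (a + 1) (k - a - 2)) ⟨1, h1⟩ = k - (a + 1) :=
    deg_bipMinusStar_small k (a + 1) (k - a - 2) (by omega) (by omega) 1 (le_refl 1) (by omega)
  have hda1 : deg (bipMinusStar k (a + 1) (k - a - 2)) ⟨a + 1, hak⟩ = a := by
    rw [deg_bipMinusStar k (a + 1) (k - a - 2) (by omega) (by omega)]
    have h0 : (⟨a + 1, hak⟩ : Fin k).val ≠ 0 := by simp only; omega
    have hst : (⟨a + 1, hak⟩ : Fin k) ∈ rightStar k (a + 1) (k - a - 2) := by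
      rw [rightStar, mem_filter]
      simp only [mem_univ, true_and]
      omega
    rw [if_neg h0, if_pos hst]
    omega
  have hda2 : deg (bipMinusStar k (a + 1) (k - a - 2)) ⟨a + 2, hak2⟩ = a := by
    rw [deg_bipMinusStar k (a + 1) (k - a - 2) (by omega) (by omega)]
    have h0 : (⟨a + 2, hak2⟩ : Fin k).val ≠ 0 := by simp only; omega
    have hst : (⟨a + 2, hak2⟩ : Fin k) ∈ rightStar k (a + 1) (k - a - 2) := by
      rw [rightStar, mem_filter]
      simp only [mem_univ, true_and]
      omega
    rw [if_neg h0, if_pos hst]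
    omega
  -- the degrees after the first deletion at `1` and `a + 2`
  have hd1' : deg (delEdge (bipMinusStar k (a + 1) (k - a - 2)) ⟨1, h1⟩ ⟨a + 1, hak⟩) ⟨1, h1⟩ = k - (a + 1) - 1 := by
    have h := deg_delEdge (bipMinusStar k (a + 1) (k - a - 2)) hadj1 ⟨1, h1⟩
    rw [if_pos (Or.inl rfl), hd1] at h
    omega
  have hda2' : deg (delEdge (bipMinusStar k (a + 1) (k - a - 2)) ⟨1, h1⟩ ⟨a + 1, hak⟩) ⟨a + 2, hak2⟩ = a := by
    have h := deg_delEdge (bipMinusStar k (a + 1) (k - a - 2)) hadj1 ⟨a + 2, hak2⟩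
    have hne : ¬ ((⟨a + 2, hak2⟩ : Fin k) = ⟨1, h1⟩ ∨ (⟨a + 2, hak2⟩ : Fin k) = ⟨a + 1, hak⟩) := by
      simp only [Fin.ext_iff]
      omega
    rw [if_neg hne, add_zero, hda2] at h
    exact h
  refine ⟨?_, ?_, ?_, ?_⟩
  · exact k4mFree_of_le _ _ (delEdge_le _ _ _)
      (k4mFree_of_le _ _ (delEdge_le _ _ _) (k4mFree_bipMinusStar k (a + 1) (k - a - 2)))
  · -- the edge count
    obtain ⟨E, hEdef⟩ : ∃ E, (bipMinusStar k (a + 1) (k - a - 2)).edgeFinset.card = E := ⟨_, rfl⟩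
    obtain ⟨E', hE'def⟩ : ∃ E', (delEdge (bipMinusStar k (a + 1) (k - a - 2)) ⟨1, h1⟩ ⟨a + 1, hak⟩).edgeFinset.card = E' := ⟨_, rfl⟩
    obtain ⟨E'', hE''def⟩ : ∃ E'', (delEdge (delEdge (bipMinusStar k (a + 1) (k - a - 2)) ⟨1, h1⟩ ⟨a + 1, hak⟩) ⟨1, h1⟩ ⟨a + 2, hak2⟩).edgeFinset.card =
        E'' := ⟨_, rfl⟩
    rw [hEdef] at hE hE1
    rw [hE'def] at hE1 hE2
    rw [hE''def] at hE2 ⊢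
    obtain ⟨q, rfl⟩ : ∃ q, a = q + 4 := ⟨a - 4, by omega⟩
    obtain ⟨c, rfl⟩ : ∃ c, k = 3 * (q + 4) + 1 + c := ⟨k - (3 * (q + 4) + 1), by omega⟩
    have e1 : 3 * (q + 4) + 1 + c - (q + 4 + 1) = 2 * q + 8 + c := by omega
    have e2 : 3 * (q + 4) + 1 + c - (q + 4) - 2 = 2 * q + 7 + c := by omega
    have e3 : 3 * (q + 4) + 1 + c - (q + 4) = 2 * q + 9 + c := by omega
    rw [e1, e2] at hE
    rw [e3]
    have hprod : (q + 4 + 1) * (2 * q + 8 + c) = (q + 4) * (2 * q + 9 + c) + (q + c + 4) := by ring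
    omega
  · -- not `a`-bipartite: the vertices `1, …, a` have degree `≥ a + 1`
    rintro ⟨A, hA, hB⟩
    have hin : ∀ v : Fin k, 1 ≤ v.val → v.val ≤ a → v ∈ A := by
      intro v hv1 hva
      by_contra hvA
      have hle := deg_le_card_of_bipSub _ A hB v hvA
      have hdel1 := deg_delEdge (bipMinusStar k (a + 1) (k - a - 2)) hadj1 v
      have hdel2 := deg_delEdge (delEdge (bipMinusStar k (a + 1) (k - a - 2)) ⟨1, h1⟩ ⟨a + 1, hak⟩) hadj2' v
      have hdeg : deg (bipMinusStar k (a + 1) (k - a - 2)) v = k - (a + 1) := by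
        have := deg_bipMinusStar_small k (a + 1) (k - a - 2) (by omega) (by omega) v.val hv1 (by omega)
        convert this
      rw [hA] at hle
      rw [hdeg] at hdel1
      have hif1 : (if v = (⟨1, h1⟩ : Fin k) ∨ v = ⟨a + 1, hak⟩ then 1 else 0) ≤ 1 := by split_ifs <;> omega
      have hif2 : (if v = (⟨1, h1⟩ : Fin k) ∨ v = ⟨a + 2, hak2⟩ then 1 else 0) ≤ 1 := by split_ifs <;> omega
      omega
    obtain ⟨S, hSdef⟩ : ∃ S : Finset (Fin k), S = Icc ⟨1, by omega⟩ ⟨a, by omega⟩ := ⟨_, rfl⟩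
    have hmemS : ∀ v : Fin k, v ∈ S ↔ 1 ≤ v.val ∧ v.val ≤ a := by
      intro v
      rw [hSdef, mem_Icc, Fin.le_def, Fin.le_def]
    have hScard : S.card = a := by
      rw [hSdef, Fin.card_Icc]
      simp only
      omega
    have hsub : S ⊆ A := fun v hv => hin v ((hmemS v).mp hv).1 ((hmemS v).mp hv).2
    have hSA : S = A := eq_of_subset_of_card_le hsub (by rw [hA, hScard])
    have h0 : (⟨0, hk0⟩ : Fin k) ∉ A := by
      rw [← hSA, hmemS]
      simp only
      omega
    have hlast : (⟨k - 1, by omega⟩ : Fin k) ∉ A := by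
      rw [← hSA, hmemS]
      simp only
      omega
    have hadj0 : (delEdge (delEdge (bipMinusStar k (a + 1) (k - a - 2)) ⟨1, h1⟩ ⟨a + 1, hak⟩) ⟨1, h1⟩ ⟨a + 2, hak2⟩).Adj ⟨0, hk0⟩ ⟨k - 1, by omega⟩ := by
      rw [delEdge_adj, delEdge_adj]
      refine ⟨⟨?_, ?_⟩, ?_⟩
      · rw [bipMinusStar_adj]
        simp only
        refine ⟨?_, ?_⟩
        · rw [Xor]; omega
        · omega
      · simp only [Fin.ext_iff]; omega
      · simp only [Fin.ext_iff]; omega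
    have := hB _ _ hadj0
    tauto
  · -- the value
    rw [hd1, hda1] at hS1
    rw [hd1', hda2'] at hS2
    generalize hS'' : (∑ v, deg (delEdge (delEdge (bipMinusStar k (a + 1) (k - a - 2)) ⟨1, h1⟩ ⟨a + 1, hak⟩)
      ⟨1, h1⟩ ⟨a + 2, hak2⟩) v * deg (delEdge (delEdge (bipMinusStar k (a + 1) (k - a - 2)) ⟨1, h1⟩ ⟨a + 1, hak⟩)
      ⟨1, h1⟩ ⟨a + 2, hak2⟩) v) = S'' at hS2 ⊢
    generalize hE'' : (delEdge (delEdge (bipMinusStar k (a + 1) (k - a - 2)) ⟨1, h1⟩ ⟨a + 1, hak⟩)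
      ⟨1, h1⟩ ⟨a + 2, hak2⟩).edgeFinset.card = E'' at hE2 ⊢
    generalize hS' : (∑ v, deg (delEdge (bipMinusStar k (a + 1) (k - a - 2)) ⟨1, h1⟩ ⟨a + 1, hak⟩) v *
      deg (delEdge (bipMinusStar k (a + 1) (k - a - 2)) ⟨1, h1⟩ ⟨a + 1, hak⟩) v) = S' at hS1 hS2
    generalize hE' : (delEdge (bipMinusStar k (a + 1) (k - a - 2)) ⟨1, h1⟩ ⟨a + 1, hak⟩).edgeFinset.card = E'
      at hE1 hE2
    generalize hSg : (∑ v, deg (bipMinusStar k (a + 1) (k - a - 2)) v * deg (bipMinusStar k (a + 1) (k - a - 2)) v)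
      = S at hS hS1
    generalize hEg : (bipMinusStar k (a + 1) (k - a - 2)).edgeFinset.card = E at hE hE1
    obtain ⟨q, rfl⟩ : ∃ q, a = q + 4 := ⟨a - 4, by omega⟩
    obtain ⟨c, rfl⟩ : ∃ c, k = 3 * (q + 4) + 1 + c := ⟨k - (3 * (q + 4) + 1), by omega⟩
    have e1 : 3 * (q + 4) + 1 + c - (q + 4 + 1) = 2 * q + 8 + c := by omega
    have e2 : 3 * (q + 4) + 1 + c - (q + 4) - 2 = 2 * q + 7 + c := by omega
    have e3 : 2 * (3 * (q + 4) + 1 + c) - (2 * q + 7 + c) - 1 = 4 * q + 18 + c := by omega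
    have e4 : 2 * q + 8 + c - 1 = 2 * q + 7 + c := by omega
    have e5 : 3 * (q + 4) + 1 + c - 1 - (q + 4 + 1) = 2 * q + 7 + c := by omega
    have e6 : 2 * (3 * (q + 4) + 1 + c) - 10 = 6 * q + 16 + 2 * c := by omega
    rw [e1, e2] at hE hS
    rw [e3] at hS
    rw [e1] at hS1
    rw [e1, e4] at hS2
    rw [e5, e6]
    zify at hE hS hE1 hS1 hE2 hS2 ⊢
    linear_combination hS2 - (3 * ((q : ℤ) + 4) + 1 + c) * hE2 + hS1 - (3 * ((q : ℤ) + 4) + 1 + c) * hE1 +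
      hS - (3 * ((q : ℤ) + 4) + 1 + c) * hE

/-- **THE NON-BIPARTITE SECOND-BEST VALUE ON THE CELL `(k, a, a + 1)`, `8 ≤ a ≤ 18`, `3a + 1 ≤ k`:** EXACTLY
`m k − (a + 1)(k − a − 2) − (2k − 10)`, attained by the double broom. -/
theorem rowA1_nonbip_second_best (k a : ℕ) (ha8 : 8 ≤ a) (ha18 : a ≤ 18) (hk : 3 * a + 1 ≤ k) :
    (∀ (D : SimpleGraph (Fin k)) [DecidableRel D.Adj], K4mFree D → D.edgeFinset.card + (a + 1) = a * (k - a) →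
        (¬ ∃ A : Finset (Fin k), A.card = a ∧ BipSub D A) →
        ∑ v, deg D v * deg D v + (a + 1) * (k - 1 - (a + 1)) + (2 * k - 10) ≤ D.edgeFinset.card * k) ∧
      ∃ (D : SimpleGraph (Fin k)) (_ : DecidableRel D.Adj), K4mFree D ∧ D.edgeFinset.card + (a + 1) = a * (k - a) ∧
        (¬ ∃ A : Finset (Fin k), A.card = a ∧ BipSub D A) ∧
        ∑ v, deg D v * deg D v + (a + 1) * (k - 1 - (a + 1)) + (2 * k - 10) = D.edgeFinset.card * k := by
  have hcard : Fintype.card (Fin k) = k := Fintype.card_fin k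
  refine ⟨?_, ?_⟩
  · intro D _ hK hm hnb
    rcases rowA1_second_order_gen D hK a ha8 ha18 (by rw [hcard]; exact hk) (by rw [hcard]; exact hm) with h | h
    · exact absurd h hnb
    · rw [hcard] at h
      exact h
  · obtain ⟨hK, hE, hnb, hS⟩ := rowA1_witness k a (by omega) hk (by omega) (by omega) (by omega)
    exact ⟨_, inferInstance, hK, hE, hnb, hS⟩

end C047

end TriangleCap

end PercRepro
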